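import Literature.Computability.Complexity.PaulPippengerSzemerediTrotter1983Auto1
import Literature.Computability.Complexity.PaulPippengerSzemerediTrotter1983Padding
import HarnessLib

/-!
# The stack program validating `y₁`: the one-counter automaton in linear time (PPST 1983, §3 — the verifier, part 2)

Literature / complexity toolkit, twenty-fourth brick of the inline formalization of
Paul–Pippenger–Szemerédi–Trotter 1983 (`PaulPippengerSzemerediTrotter1983.lean`, fact
`PaulEtAl1983_NTIME_not_subset_DTIME`; roadmap Layer 4, machines, part 5). The automaton of
`…Auto1.lean` as a structured binary stack program (`Com`, `StackPrograms.lean`): the input is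
read two bits per token; the phase, freshness and error are one-symbol flags; the field counter
`st` and the record count are unary registers; comparing the counter with the constant
`R = 9K + 2` is a gadget of `R` guarded pops that restores (`ltC`) or consumes (`eqC`) it. One
token costs `O(R)`, so the whole word costs `O(R |y₁|)`:

* `S1R` (registers), `mk6` (register files) with its `simp` interface; `pushN`, `clr1`, `setF`;
* `ltC`, `runs_ltC` (is the counter `< k`? — restoring), `eqC`, `runs_eqC` (is it `= k`? — consuming);
* `dataStep`, `sepStep`, `stopStep`, `scanBody`, **`scan1 R`**; `a1bits` (the automaton on raw
  bits, with the dangling-bit error) and `a1bits_eq_a1run`;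
* **`runs_scan1`**: `Runs (scan1 R) (mk6 y …registers of s…) (mk6 [] …registers of (a1bits R s y)…) ((3R + 30) |y| + 1)`.

No named fact is introduced (definitions with bodies and theorems only).

## References

* W. J. Paul, N. Pippenger, E. Szemerédi, W. T. Trotter, *On determinism versus non-determinism
  and related problems*, FOCS 1983, 429–438, §3 [PaulEtAl1983].
-/

namespace Literature.Computability.Complexity

open Function Com

namespace PPSTScan

/-! ### Registers and register files -/

/-- Registers of the `y₁` scanner: input, phase flag (set once in the records), freshness flag,
field counter, record count (`ct`), error flag. [folklore] -/
inductive S1R : Type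
  | src | ph | fr | st | ct | g
  deriving DecidableEq, Fintype

open S1R

/-- Register files by content. [folklore] -/
def mk6 (a b c d e f : List Bool) : Regs S1R
  | .src => a
  | .ph => b
  | .fr => c
  | .st => d
  | .ct => e
  | .g => f

section Mk6

variable (a b c d e f v : List Bool)

/-- Reading. [folklore] -/ @[simp] theorem mk6_src : mk6 a b c d e f src = a := rfl
/-- Reading. [folklore] -/ @[simp] theorem mk6_ph : mk6 a b c d e f ph = b := rfl
/-- Reading. [folklore] -/ @[simp] theorem mk6_fr : mk6 a b c d e f fr = c := rfl
/-- Reading. [folklore] -/ @[simp] theorem mk6_st : mk6 a b c d e f st = d := rfl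
/-- Reading. [folklore] -/ @[simp] theorem mk6_ct : mk6 a b c d e f ct = e := rfl
/-- Reading. [folklore] -/ @[simp] theorem mk6_g : mk6 a b c d e f g = f := rfl
/-- Writing. [folklore] -/
@[simp] theorem update_mk6_src : update (mk6 a b c d e f) src v = mk6 v b c d e f := by
  funext r; cases r <;> rfl
/-- Writing. [folklore] -/
@[simp] theorem update_mk6_ph : update (mk6 a b c d e f) ph v = mk6 a v c d e f := by
  funext r; cases r <;> rfl
/-- Writing. [folklore] -/
@[simp] theorem update_mk6_fr : update (mk6 a b c d e f) fr v = mk6 a b v d e f := by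
  funext r; cases r <;> rfl
/-- Writing. [folklore] -/
@[simp] theorem update_mk6_st : update (mk6 a b c d e f) st v = mk6 a b c v e f := by
  funext r; cases r <;> rfl
/-- Writing. [folklore] -/
@[simp] theorem update_mk6_ct : update (mk6 a b c d e f) ct v = mk6 a b c d v f := by
  funext r; cases r <;> rfl
/-- Writing. [folklore] -/
@[simp] theorem update_mk6_g : update (mk6 a b c d e f) g v = mk6 a b c d e v := by
  funext r; cases r <;> rfl

end Mk6

/-! ### Small gadgets -/

section Gadgets

variable {ι : Type} [DecidableEq ι]

/-- `n` pushes of `true` on `r`. [folklore] -/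
def pushN (r : ι) : ℕ → Com ι
  | 0 => skip
  | n + 1 => push r true ;; pushN r n

/-- `pushN r n` adds `n` units, in `n` steps. [folklore] -/
theorem runs_pushN (r : ι) : ∀ (n : ℕ) (R : Regs ι), Runs (pushN r n) R (update R r (ones n ++ R r)) n
  | 0, R => (Runs.skip R).of_eq (by simp) le_rfl
  | n + 1, R => by
    refine ((Runs.push r true R).seq (runs_pushN r n _)).of_eq ?_ (by omega)
    rw [Function.update_idem, Function.update_self]
    congr 1
    simp [ones, List.replicate_succ']

/-- Clear a flag register (at most one symbol is removed). [folklore] -/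
def clr1 (r : ι) : Com ι := pop r skip skip skip

/-- `clr1` on a flag. [folklore] -/
theorem runs_clr1_flag (r : ι) (R : Regs ι) (x : Bool) (hr : R r = flag x) :
    Runs (clr1 r) R (update R r []) 2 := by
  cases x
  · simp only [flag_false] at hr
    exact (Runs.pop_nil skip skip hr (Runs.skip R)).of_eq (by rw [← hr, Function.update_eq_self]) (by omega)
  · simp only [flag_true] at hr
    exact Runs.pop_true skip skip hr ((Runs.skip _).of_eq rfl le_rfl)

/-- Set a flag register. [folklore] -/
def setF (r : ι) : Com ι := clr1 r ;; push r true

/-- `setF` on a flag. [folklore] -/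
theorem runs_setF_flag (r : ι) (R : Regs ι) (x : Bool) (hr : R r = flag x) :
    Runs (setF r) R (update R r [true]) 3 := by
  refine ((runs_clr1_flag r R x hr).seq (Runs.push r true _)).of_eq ?_ le_rfl
  simp

/-- **Is the unary counter `< k`?** Pop up to `k` units (`p` popped before), restore, branch.
[folklore] -/
def ltC (st : ι) (onLt onGe : Com ι) : ℕ → ℕ → Com ι
  | 0, p => pushN st p ;; onGe
  | k + 1, p => pop st (ltC st onLt onGe k (p + 1)) (ltC st onLt onGe k (p + 1)) (pushN st p ;; onLt)

/-- `1ᵖ ++ 1ˢ = 1^{s+p}`. [folklore] -/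
theorem ones_append_ones (p s : ℕ) : ones p ++ ones s = ones (s + p) := by
  simp [Nat.add_comm]

/-- **Effect of `ltC`** on a counter `st = 1ˢ`: the counter ends as `1^{s+p}` (restored when
`p = 0`) and the branch `onLt` / `onGe` runs according to `s < k`; cost `≤ 3k + p + 2` plus the
branch. [folklore] -/
theorem runs_ltC (st : ι) (onLt onGe : Com ι) : ∀ (k p s : ℕ) (R R' : Regs ι) (c : ℕ), R st = ones s →
    (s < k → Runs onLt (update R st (ones (s + p))) R' c) →
    (k ≤ s → Runs onGe (update R st (ones (s + p))) R' c) →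
    Runs (ltC st onLt onGe k p) R R' (3 * k + p + 2 + c)
  | 0, p, s, R, R', c, hst, _, hGe => by
    have h1 := runs_pushN st p R
    rw [hst, ones_append_ones] at h1
    have h2 := hGe (Nat.zero_le _)
    exact (h1.seq h2).of_eq rfl (by omega)
  | k + 1, p, s, R, R', c, hst, hLt, hGe => by
    rcases s with _ | s
    · -- empty counter: `s = 0 < k + 1`
      have h0 : R st = [] := by rw [hst]; rfl
      have h1 := runs_pushN st p R
      rw [h0, List.append_nil, show ones p = ones (0 + p) by rw [Nat.zero_add]] at h1
      have h2 := hLt (Nat.succ_pos k)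
      have hin := h1.seq h2
      exact (Runs.pop_nil _ _ h0 hin).of_eq rfl (by omega)
    · have h1 : R st = true :: ones s := by rw [hst]; rfl
      have ih := runs_ltC st onLt onGe k (p + 1) s (update R st (ones s)) R' c (by simp)
        (fun hlt => by
          have := hLt (by omega)
          rwa [Function.update_idem, show s + (p + 1) = s + 1 + p by omega])
        (fun hge => by
          have := hGe (by omega)
          rwa [Function.update_idem, show s + (p + 1) = s + 1 + p by omega])
      exact (Runs.pop_true _ _ h1 ih).of_eq rfl (by omega)

/-- **Is the unary counter `= k`?** Pop `k + 1` times: exactly `k` units then empty means yes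
(and the counter is now empty); otherwise no (and the counter holds `1^{s-(k+1)}`).
[folklore] -/
def eqC (st : ι) (onEq onNe : Com ι) : ℕ → Com ι
  | 0 => pop st onNe onNe onEq
  | k + 1 => pop st (eqC st onEq onNe k) (eqC st onEq onNe k) onNe

/-- **Effect of `eqC`** on `st = 1ˢ`; cost `≤ 2k + 2` plus the branch. [folklore] -/
theorem runs_eqC (st : ι) (onEq onNe : Com ι) : ∀ (k s : ℕ) (R R' : Regs ι) (c : ℕ), R st = ones s →
    (s = k → Runs onEq (update R st []) R' c) →
    (s ≠ k → Runs onNe (update R st (ones (s - (k + 1)))) R' c) →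
    Runs (eqC st onEq onNe k) R R' (2 * k + 2 + c)
  | 0, s, R, R', c, hst, hEq, hNe => by
    rcases s with _ | s
    · have h0 : R st = [] := by rw [hst]; rfl
      have hin := hEq rfl
      rw [← h0, Function.update_eq_self] at hin
      exact (Runs.pop_nil _ _ h0 hin).of_eq rfl (by omega)
    · have h1 : R st = true :: ones s := by rw [hst]; rfl
      have hin := hNe (by omega)
      rw [show s + 1 - (0 + 1) = s by omega] at hin
      exact (Runs.pop_true _ _ h1 hin).of_eq rfl (by omega)
  | k + 1, s, R, R', c, hst, hEq, hNe => by
    rcases s with _ | s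
    · have h0 : R st = [] := by rw [hst]; rfl
      have hin := hNe (by omega)
      rw [show 0 - (k + 1 + 1) = 0 by omega, show ones 0 = R st by rw [h0]; rfl, Function.update_eq_self] at hin
      exact (Runs.pop_nil _ _ h0 hin).of_eq rfl (by omega)
    · have h1 : R st = true :: ones s := by rw [hst]; rfl
      have ih := runs_eqC st onEq onNe k s (update R st (ones s)) R' c (by simp)
        (fun heq => by have := hEq (by omega); rwa [Function.update_idem])
        (fun hne => by
          have := hNe (by omega)
          rwa [Function.update_idem, show s - (k + 1) = s + 1 - (k + 1 + 1) by omega])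
      exact (Runs.pop_true _ _ h1 ih).of_eq rfl (by omega)

end Gadgets

/-! ### The scanner -/

open PPSTSpec

variable (R : ℕ)

/-- Inside the records, a data token: un-fresh; error unless inside a field. [folklore] -/
def inRecD : Com S1R := push ph true ;; clr1 fr ;; ltC st skip (markBad g) R 0

/-- A data token. [folklore] -/
def dataStep : Com S1R := pop ph (inRecD R) (inRecD R) skip

/-- Inside the records, an end of field: un-fresh; count the field unless all were there. [folklore] -/
def inRecS : Com S1R := push ph true ;; clr1 fr ;; ltC st (push st true) (markBad g) R 0

/-- An end of field (in the header: enter the records, fresh). [folklore] -/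
def sepStep : Com S1R := pop ph (inRecS R) (inRecS R) (push ph true ;; setF fr)

/-- Inside the records, an end of record: exactly `R` fields must be there; count the record,
fresh again. [folklore] -/
def inRecT : Com S1R := push ph true ;; clr1 fr ;; eqC st (push ct true ;; push fr true) (markBad g) R

/-- An end of record (in the header: error). [folklore] -/
def stopStep : Com S1R := pop ph (inRecT R) (inRecT R) (markBad g)

/-- The loop body on the first bit of a token: read the second bit and dispatch; a dangling bit
is an error. [folklore] -/
def scanBody : Bool → Com S1R
  | true => pop src (dataStep R) (dataStep R) (markBad g)
  | false => pop src (stopStep R) (sepStep R) (markBad g)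

/-- **The `y₁` scanner.** [folklore] -/
def scan1 : Com S1R := loop src (scanBody R true) (scanBody R false)

/-- The register file of an automaton state with input `y`. [folklore] -/
def stFile (y : List Bool) (s : A1St) : Regs S1R :=
  mk6 y (flag (!s.hdr)) (flag s.fresh) (ones s.st) (ones s.cnt) (flag s.err)

/-- The token of two bits. [folklore] -/
def tokOf (t d : Bool) : PPSTSpec.Tok := if t then .bit d else if d then .stop else .sep

/-- **The automaton on raw bits**, with the dangling-bit error. [folklore] -/
def a1bits (s : A1St) : List Bool → A1St
  | [] => s
  | [_] => { s with err := true }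
  | t :: d :: y => a1bits (a1step R s (tokOf t d)) y

/-- On a token stream the bit automaton is the token automaton. [folklore] -/
theorem a1bits_eq_a1run (s : A1St) : ∀ (y : List Bool) (ts : List PPSTSpec.Tok), toks y = some ts → a1bits R s y = a1run R s ts
  | [], ts, h => by simp only [toks, Option.some.injEq] at h; subst h; rfl
  | [_], ts, h => by simp [toks] at h
  | t :: d :: y, ts, h => by
    have key : ∀ tk : PPSTSpec.Tok, (toks y).map (tk :: ·) = some ts → tokOf t d = tk → a1bits R s (t :: d :: y) = a1run R s ts := by
      intro tk htk htok
      simp only [Option.map_eq_some_iff] at htk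
      obtain ⟨ts', h1, rfl⟩ := htk
      rw [a1run_cons, ← htok]
      exact a1bits_eq_a1run _ y ts' h1
    cases t <;> cases d
    · exact key _ h rfl
    · exact key _ h rfl
    · exact key _ h rfl
    · exact key _ h rfl

/-- A non-stream (dangling bit) ends in error. [folklore] -/
theorem a1bits_err (s : A1St) : ∀ (y : List Bool), toks y = none → (a1bits R s y).err = true
  | [], h => by simp [toks] at h
  | [_], _ => rfl
  | t :: d :: y, h => by
    have key : ∀ tk : PPSTSpec.Tok, (toks y).map (tk :: ·) = none → (a1bits R s (t :: d :: y)).err = true := by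
      intro tk htk
      simp only [Option.map_eq_none_iff] at htk
      exact a1bits_err _ y htk
    cases t <;> cases d
    · exact key _ h
    · exact key _ h
    · exact key _ h
    · exact key _ h

/-! ### One token -/

/-- **A data token** costs at most `3R + 11`. [folklore] -/
theorem runs_dataStep (y : List Bool) (s : A1St) (d : Bool) :
    Runs (dataStep R) (stFile y s) (stFile y (a1step R s (.bit d))) (3 * R + 11) := by
  unfold dataStep stFile
  cases hh : s.hdr
  · -- in the records
    simp only [Bool.not_false, flag_true, a1step, hh, Bool.false_eq_true, ↓reduceIte]
    have hin : Runs (inRecD R) (mk6 y [] (flag s.fresh) (ones s.st) (ones s.cnt) (flag s.err))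
        (if s.st < R then mk6 y [true] [] (ones s.st) (ones s.cnt) (flag s.err)
         else mk6 y [true] [] (ones s.st) (ones s.cnt) [true]) (1 + 2 + (3 * R + 0 + 2 + 4)) := by
      unfold inRecD
      have h1 : Runs (push ph true) (mk6 y [] (flag s.fresh) (ones s.st) (ones s.cnt) (flag s.err))
          (mk6 y [true] (flag s.fresh) (ones s.st) (ones s.cnt) (flag s.err)) 1 := Runs.push' (by simp)
      have h2 : Runs (clr1 fr) (mk6 y [true] (flag s.fresh) (ones s.st) (ones s.cnt) (flag s.err))
          (mk6 y [true] [] (ones s.st) (ones s.cnt) (flag s.err)) 2 :=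
        (runs_clr1_flag fr _ s.fresh (by simp)).of_eq (by simp) le_rfl
      have h3 := runs_ltC st skip (markBad g) R 0 s.st (mk6 y [true] [] (ones s.st) (ones s.cnt) (flag s.err))
        (if s.st < R then mk6 y [true] [] (ones s.st) (ones s.cnt) (flag s.err)
         else mk6 y [true] [] (ones s.st) (ones s.cnt) [true]) 4 (by simp)
        (fun hlt => by rw [if_pos hlt]; exact (Runs.skip _).of_eq (by simp) (by omega))
        (fun hge => by
          rw [if_neg (by omega)]
          exact (runs_markBad_flag (g := g) _ s.err (by simp)).of_eq (by simp) le_rfl)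
      exact (h1.seq (h2.seq h3)).of_eq rfl (by omega)
    rw [show mk6 y [] (flag s.fresh) (ones s.st) (ones s.cnt) (flag s.err) =
        update (mk6 y [true] (flag s.fresh) (ones s.st) (ones s.cnt) (flag s.err)) ph [] by simp] at hin
    have hrun := Runs.pop_true (inRecD R) skip (by simp) hin
    split_ifs at hrun with hlt
    · exact hrun.of_eq (by simp [hlt]) (by omega)
    · exact hrun.of_eq (by simp [hlt]) (by omega)
  · -- in the header
    simp only [Bool.not_true, flag_false, a1step, hh, ↓reduceIte]
    exact (Runs.pop_nil _ _ (by simp) (Runs.skip _)).of_eq rfl (by omega)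

/-- **An end of field** costs at most `3R + 11`. [folklore] -/
theorem runs_sepStep (y : List Bool) (s : A1St) :
    Runs (sepStep R) (stFile y s) (stFile y (a1step R s .sep)) (3 * R + 11) := by
  unfold sepStep stFile
  cases hh : s.hdr
  · simp only [Bool.not_false, flag_true, a1step, hh, Bool.false_eq_true, ↓reduceIte]
    have hin : Runs (inRecS R) (mk6 y [] (flag s.fresh) (ones s.st) (ones s.cnt) (flag s.err))
        (if s.st < R then mk6 y [true] [] (ones (s.st + 1)) (ones s.cnt) (flag s.err)
         else mk6 y [true] [] (ones s.st) (ones s.cnt) [true]) (1 + 2 + (3 * R + 0 + 2 + 4)) := by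
      unfold inRecS
      have h1 : Runs (push ph true) (mk6 y [] (flag s.fresh) (ones s.st) (ones s.cnt) (flag s.err))
          (mk6 y [true] (flag s.fresh) (ones s.st) (ones s.cnt) (flag s.err)) 1 := Runs.push' (by simp)
      have h2 : Runs (clr1 fr) (mk6 y [true] (flag s.fresh) (ones s.st) (ones s.cnt) (flag s.err))
          (mk6 y [true] [] (ones s.st) (ones s.cnt) (flag s.err)) 2 :=
        (runs_clr1_flag fr _ s.fresh (by simp)).of_eq (by simp) le_rfl
      have h3 := runs_ltC st (push st true) (markBad g) R 0 s.st (mk6 y [true] [] (ones s.st) (ones s.cnt) (flag s.err))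
        (if s.st < R then mk6 y [true] [] (ones (s.st + 1)) (ones s.cnt) (flag s.err)
         else mk6 y [true] [] (ones s.st) (ones s.cnt) [true]) 4 (by simp)
        (fun hlt => by
          rw [if_pos hlt]
          exact (Runs.push' (by simp; rfl)).of_eq rfl (by omega))
        (fun hge => by
          rw [if_neg (by omega)]
          exact (runs_markBad_flag (g := g) _ s.err (by simp)).of_eq (by simp) le_rfl)
      exact (h1.seq (h2.seq h3)).of_eq rfl (by omega)
    rw [show mk6 y [] (flag s.fresh) (ones s.st) (ones s.cnt) (flag s.err) =
        update (mk6 y [true] (flag s.fresh) (ones s.st) (ones s.cnt) (flag s.err)) ph [] by simp] at hin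
    have hrun := Runs.pop_true (inRecS R) (push ph true ;; setF fr) (by simp) hin
    split_ifs at hrun with hlt
    · exact hrun.of_eq (by simp [hlt]) (by omega)
    · exact hrun.of_eq (by simp [hlt]) (by omega)
  · simp only [Bool.not_true, flag_false, a1step, hh, ↓reduceIte]
    have h1 : Runs (push ph true) (mk6 y [] (flag s.fresh) (ones s.st) (ones s.cnt) (flag s.err))
        (mk6 y [true] (flag s.fresh) (ones s.st) (ones s.cnt) (flag s.err)) 1 := Runs.push' (by simp)
    have h2 := runs_setF_flag fr (mk6 y [true] (flag s.fresh) (ones s.st) (ones s.cnt) (flag s.err)) s.fresh (by simp)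
    have hin := h1.seq h2
    exact (Runs.pop_nil _ _ (by simp) hin).of_eq (by simp) (by omega)

/-- **An end of record** costs at most `3R + 11`. [folklore] -/
theorem runs_stopStep (y : List Bool) (s : A1St) :
    Runs (stopStep R) (stFile y s) (stFile y (a1step R s .stop)) (3 * R + 11) := by
  unfold stopStep stFile
  cases hh : s.hdr
  · simp only [Bool.not_false, flag_true, a1step, hh, Bool.false_eq_true, ↓reduceIte]
    have hin : Runs (inRecT R) (mk6 y [] (flag s.fresh) (ones s.st) (ones s.cnt) (flag s.err))
        (if s.st = R then mk6 y [true] [true] (ones 0) (ones (s.cnt + 1)) (flag s.err)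
         else mk6 y [true] [] (ones (s.st - (R + 1))) (ones s.cnt) [true]) (1 + 2 + (2 * R + 2 + 4)) := by
      unfold inRecT
      have h1 : Runs (push ph true) (mk6 y [] (flag s.fresh) (ones s.st) (ones s.cnt) (flag s.err))
          (mk6 y [true] (flag s.fresh) (ones s.st) (ones s.cnt) (flag s.err)) 1 := Runs.push' (by simp)
      have h2 : Runs (clr1 fr) (mk6 y [true] (flag s.fresh) (ones s.st) (ones s.cnt) (flag s.err))
          (mk6 y [true] [] (ones s.st) (ones s.cnt) (flag s.err)) 2 :=
        (runs_clr1_flag fr _ s.fresh (by simp)).of_eq (by simp) le_rfl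
      have h3 := runs_eqC st (push ct true ;; push fr true) (markBad g) R s.st
        (mk6 y [true] [] (ones s.st) (ones s.cnt) (flag s.err))
        (if s.st = R then mk6 y [true] [true] (ones 0) (ones (s.cnt + 1)) (flag s.err)
         else mk6 y [true] [] (ones (s.st - (R + 1))) (ones s.cnt) [true]) 4 (by simp)
        (fun heq => by
          rw [if_pos heq]
          exact ((Runs.push' (k := ct) (b := true) rfl).seq (Runs.push' (k := fr) (b := true) rfl)).of_eq
            (by simp; rfl) (by omega))
        (fun hne => by
          rw [if_neg hne]
          exact (runs_markBad_flag (g := g) _ s.err (by simp)).of_eq (by simp) le_rfl)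
      exact (h1.seq (h2.seq h3)).of_eq rfl (by omega)
    rw [show mk6 y [] (flag s.fresh) (ones s.st) (ones s.cnt) (flag s.err) =
        update (mk6 y [true] (flag s.fresh) (ones s.st) (ones s.cnt) (flag s.err)) ph [] by simp] at hin
    have hrun := Runs.pop_true (inRecT R) (markBad g) (by simp) hin
    split_ifs at hrun with heq
    · exact hrun.of_eq (by simp [heq]) (by omega)
    · exact hrun.of_eq (by simp [heq]) (by omega)
  · simp only [Bool.not_true, flag_false, a1step, hh, ↓reduceIte]
    have hin := runs_markBad_flag (g := g) (mk6 y [] (flag s.fresh) (ones s.st) (ones s.cnt) (flag s.err)) s.err (by simp)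
    exact (Runs.pop_nil _ _ (by simp) hin).of_eq (by simp) (by omega)

/-- **One token**: from `src = d :: y` the body on the first bit `t` leaves the registers of the
stepped state. [folklore] -/
theorem runs_scanBody (t d : Bool) (y : List Bool) (s : A1St) :
    Runs (scanBody R t) (stFile (d :: y) s) (stFile y (a1step R s (tokOf t d))) (3 * R + 13) := by
  have hsrc : stFile (d :: y) s src = d :: y := rfl
  have hupd : update (stFile (d :: y) s) src y = stFile y s := by unfold stFile; simp
  cases t
  · unfold scanBody
    cases d
    · have h := runs_sepStep R y s
      rw [← hupd] at h
      exact (Runs.pop_false _ _ hsrc h).of_eq (by simp [tokOf]) (by omega)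
    · have h := runs_stopStep R y s
      rw [← hupd] at h
      exact (Runs.pop_true _ _ hsrc h).of_eq (by simp [tokOf]) (by omega)
  · unfold scanBody
    cases d
    · have h := runs_dataStep R y s false
      rw [← hupd] at h
      exact (Runs.pop_false _ _ hsrc h).of_eq (by simp [tokOf]) (by omega)
    · have h := runs_dataStep R y s true
      rw [← hupd] at h
      exact (Runs.pop_true _ _ hsrc h).of_eq (by simp [tokOf]) (by omega)

/-- A dangling bit: the body on an empty input sets the error. [folklore] -/
theorem runs_scanBody_nil (t : Bool) (s : A1St) :
    Runs (scanBody R t) (stFile [] s) (stFile [] { s with err := true }) 6 := by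
  have hsrc : stFile [] s src = [] := rfl
  have h := runs_markBad_flag (g := g) (stFile [] s) s.err rfl
  have he : update (stFile [] s) g [true] = stFile [] { s with err := true } := by unfold stFile; simp
  rw [he] at h
  cases t <;> exact (Runs.pop_nil _ _ hsrc h).of_eq rfl (by omega)

/-- **The scanner runs the automaton in linear time.** [folklore] -/
theorem runs_scan1 : ∀ (y : List Bool) (s : A1St),
    Runs (scan1 R) (stFile y s) (stFile [] (a1bits R s y)) ((3 * R + 17) * y.length + 1)
  | [], s => (Runs.loop_nil _ _ rfl).of_eq rfl (by simp)
  | [t], s => by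
    have hb := runs_scanBody_nil R t s
    have hupd : update (stFile [t] s) src [] = stFile [] s := by unfold stFile; simp
    rw [← hupd] at hb
    have hl : Runs (scan1 R) (stFile [] { s with err := true }) (stFile [] { s with err := true }) 1 :=
      Runs.loop_nil _ _ rfl
    cases t
    · exact (Runs.loop_false (by rfl) hb hl).of_eq rfl (by simp)
    · exact (Runs.loop_true (by rfl) hb hl).of_eq rfl (by simp)
  | t :: d :: y, s => by
    have hb := runs_scanBody R t d y s
    have hupd : update (stFile (t :: d :: y) s) src (d :: y) = stFile (d :: y) s := by unfold stFile; simp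
    rw [← hupd] at hb
    have ih := runs_scan1 y (a1step R s (tokOf t d))
    cases t
    · exact (Runs.loop_false (by rfl) hb ih).of_eq rfl (by simp; ring_nf; omega)
    · exact (Runs.loop_true (by rfl) hb ih).of_eq rfl (by simp; ring_nf; omega)

end PPSTScan

end Literature.Computability.Complexity
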